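import Summits.QuantumFields.BalabanUV.Beta.D1BFx.SliceTransferModel
import Literature.MathematicalPhysics.QuantumFieldTheory.Balaban1983to89.Beta.CompositionSingular

/-!
# `BalabanUV.Beta.FP.HorizontalModel` — road «FP» for binder row D1, leaf (H1) of the HORIZONTAL ROUTE (owner ruling R-FP-15,
# `HOME/b2b-balaban-beta-d1-p3/N7-PROOF.v2.md` §1) AT MODEL LEVEL: the one-loop functional of the UNCONSTRAINED fine system equals that of
# BAŁABAN's BLOCK-CONSTRAINED STEP plus that of the COARSE EFFECTIVE system — the cell's composition law read «horizontally», along C² background curves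

HONEST DEPENDENCY (page 1, mandatory): continuum YM on T⁴ ⇐ BetaPertH ∧ nine spine estimates (0/9 proved); BetaPertH ⇐ (D1) ∧ (D4) ∧ CAP+tail;
G-an2-4 gates asym, D1 and NE2/3/4.  HONEST FRAMING (cell contract, verbatim): «discharging `BetaPertH` makes Bałaban's UV stability UNCONDITIONAL —
a real constructive-QFT result; it is NOT the continuum limit and NOT the Clay problem.»  THIS MODULE DISCHARGES NOTHING of the wall: it is [folklore]
finite-dimensional algebra ∕ calculus over the tree's `Beta.CompositionSingular` (the composition law under the single bordered hypothesis,
`det_kkt_compForm_of_kkt`, effective form `effForm`) and road BF-x's `D1BFx.LogDetSecondVariation` ∕ `D1BFx.SliceTransferModel` (the one-loop functional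
`secondVar` of a 2-jet, `secondVar_comb_eq_zero`, jets of bordered matrices).  No `def`, no `def … : Prop`, no cited fact, 0 sorry; 0 wall binders touched;
NOT D1, NOT BetaPertH, NOT continuum, NOT Clay.

ABSOLUTE RULE (cell charter, verbatim): «No internally-minted statement may enter as a cited fact. Every hypothesis is either kernel-proved in this package or a
verbatim quotation of a PUBLISHED theorem with page reference. The manuscript(s) under audit are NOT citable for their own disputed steps — they are the thing
under adjudication; programme-internal (2001/route/tribunal) claims are never citable.»

THE THREE SYSTEMS.  A fine quadratic form `H` (on the fine index type `ν`; on the road: the level-∞ perfect form at a fine background, with Bałaban's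
gauge-fixing WEIGHT already inside `H` — `H` itself may be degenerate along the coarse gauge directions), the block-averaging constraint `Q : μ × ν`, and a
slice `T : κ × μ` of the COARSE variable.  Then
* (F) `kkt H (T·Q)` — the fine system with NO block constraint, bordered only by the coarse slice pulled back along `Q` (a complete gauge fixing of the
  unconstrained fine theory: fine weight + coarse slice of the block averages);
* (B) `kkt H Q` — BAŁABAN's ONE SHOT: the fine fluctuation with ZERO block averages (invertible iff `Q` is onto and `H` is non-degenerate on `ker Q` — the
  «single bordered hypothesis» of `CompositionSingular`);
* (C) `kkt (effForm H Q) T` — the COARSE EFFECTIVE theory: the tree-level effective form `effForm H Q = −((kkt H Q)⁻¹)₂₂` of the block variable, sliced by `T`.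
§1 `det_threeSystems`: `det (F) = (−1)^{|μ|}·det (B)·det (C)` — `CompositionSingular.det_kkt_compForm_of_kkt` at `G := 0` (NO Gram factor, NO Faddeev–Popov term:
every slice here is a weight inside `H` or a sharp border); `absDet_threeSystems`, `logAbsDet_threeSystems`.
§2 `secondVar_threeSystems`: along `C²` background curves `u ↦ (H(u), Q(u))` with the coarse slice `T` background-INDEPENDENT and ANY `C²` curve `E(u)` that COINCIDES
with `effForm (H u) (Q u)` near `u = 0` (so the statement needs no derivative of `effForm`): at `u = 0`,
`secondVar (F) = secondVar (B) + secondVar (C)` with the 2-jets `kkt H₁ (T·Q₁)`, `kkt H₂ (T·Q₂)` ∕ `kkt H₁ Q₁`, `kkt H₂ Q₂` ∕ `kkt E₁ 0`, `kkt E₂ 0`.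
READING for road FP (R-FP-15; orientation only, nothing asserted): with `H` the perfect fine form at background `B = U_n(V)` (the perfect n-fold minimiser of the
coarse background `V`), (B)'s functional is the perfect one-shot kernel `T_n` of the road's END (`TGenOf (Lc^m) (KPerfOf …) …`), (C)'s is the one-loop polarization
of the coarse perfect theory (STATIONARITY: `effForm` of the perfect form is the perfect form again — a kernel-level statement, NOT here), and (F)'s is the one-loop
polarization `Π` of the UNCONSTRAINED perfect fine theory transported by the minimiser: `𝓘_nᵀ Π 𝓘_n = T_n + Π^{[n]} + D_n` — the identity that carries the whole
`n`-dependence of road FP's analytic leaf `hasym` and leaves ONE explicit kernel `Π` to be estimated (N7-PROOF.v2 (H2)).  The first-variation cross term of the chain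
rule and the conversion of (F), (C) to slice-independent ORBIT polarizations (`OrbitPolarization`) are the `D_n` bookkeeping, not in this file.  The kernel-level
transcription for the typed perfect objects is the SAME debt as the composition lane's (`D1Tel`, hSDF); this file is its model.
Provenance: road FP owner b2b-balaban-beta-d1-p3 gen 4 (prover-b2b-balaban-beta-d1-p3-g4-0), 2026-08-20.  [folklore], 0 def, 0 cite, 0 sorry.
-/

noncomputable section

namespace Summit.QuantumFields.BalabanUV.Beta.FP.HorizontalModel

open Matrix Filter Finset
open scoped Topology
open Literature.MathematicalPhysics.QuantumFieldTheory.Balaban1983to89.Beta.Composition (kkt compForm)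
open Literature.MathematicalPhysics.QuantumFieldTheory.Balaban1983to89.Beta.CompositionSingular (effForm det_kkt_compForm_of_kkt)
open Literature.Analysis.Calculus (eventually_det_ne_zero)
open Summit.QuantumFields.BalabanUV.Beta.D1BFx.LogDetSecondVariation (secondVar secondVar_comb_eq_zero)
open Summit.QuantumFields.BalabanUV.Beta.D1BFx.SliceTransferModel (hasDerivAt_kkt hasDerivAt_const_mul)

/-! ## §1 The determinant identity of the three systems (any field) -/

section Det

variable {𝕜 : Type*} [Field 𝕜]
variable {ν μ κ : Type*} [Fintype ν] [Fintype μ] [Fintype κ] [DecidableEq ν] [DecidableEq μ] [DecidableEq κ]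

omit [Fintype ν] [DecidableEq ν] [DecidableEq μ] in
/-- [folklore] `compForm H Q 0 = H`: composing with the zero block form changes nothing. -/
theorem compForm_zero (H : Matrix ν ν 𝕜) (Q : Matrix μ ν 𝕜) : compForm H Q (0 : Matrix μ μ 𝕜) = H := by
  simp [compForm]

/-- [folklore] **THE THREE-SYSTEM DETERMINANT IDENTITY** (the composition law `CompositionSingular.det_kkt_compForm_of_kkt` at `G := 0`): under the
single bordered hypothesis `IsUnit (kkt H Q).det`, for every coarse slice `T`,
`det kkt H (T·Q) = (−1)^{|μ|} · det kkt H Q · det kkt (effForm H Q) T` — fine-unconstrained = Bałaban's one shot × coarse effective. -/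
theorem det_threeSystems (H : Matrix ν ν 𝕜) (Q : Matrix μ ν 𝕜) (T : Matrix κ μ 𝕜) (h : IsUnit (kkt H Q).det) :
    (kkt H (T * Q)).det = (-1) ^ Fintype.card μ * ((kkt H Q).det * (kkt (effForm H Q) T).det) := by
  have h0 := det_kkt_compForm_of_kkt H Q (0 : Matrix μ μ 𝕜) T h
  rwa [compForm_zero, add_zero] at h0

end Det

/-! ## §2 Over `ℝ`: absolute values, logarithms, and the second variation along background curves -/

section Real

variable {ν μ κ : Type*} [Fintype ν] [Fintype μ] [Fintype κ] [DecidableEq ν] [DecidableEq μ] [DecidableEq κ]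

/-- [folklore] Absolute form: `|det kkt H (T·Q)| = |det kkt H Q| · |det kkt (effForm H Q) T|`. -/
theorem absDet_threeSystems (H : Matrix ν ν ℝ) (Q : Matrix μ ν ℝ) (T : Matrix κ μ ℝ) (h : (kkt H Q).det ≠ 0) :
    |(kkt H (T * Q)).det| = |(kkt H Q).det| * |(kkt (effForm H Q) T).det| := by
  rw [det_threeSystems H Q T (isUnit_iff_ne_zero.mpr h), abs_mul, abs_mul, abs_pow, abs_neg, abs_one, one_pow, one_mul]

/-- [folklore] The fine-unconstrained system is non-degenerate iff the coarse effective one is (given Bałaban's bordered hypothesis). -/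
theorem det_threeSystems_ne_zero_iff (H : Matrix ν ν ℝ) (Q : Matrix μ ν ℝ) (T : Matrix κ μ ℝ) (h : (kkt H Q).det ≠ 0) :
    (kkt H (T * Q)).det ≠ 0 ↔ (kkt (effForm H Q) T).det ≠ 0 := by
  rw [← abs_ne_zero, absDet_threeSystems H Q T h, mul_ne_zero_iff, abs_ne_zero, abs_ne_zero]
  exact ⟨fun hh => hh.2, fun hh => ⟨h, hh⟩⟩

/-- [folklore] Logarithmic form: `log|det kkt H (T·Q)| = log|det kkt H Q| + log|det kkt (effForm H Q) T|` when the two factors are non-degenerate —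
«log Z (fine, unconstrained) = log Z (one shot) + log Z (coarse effective)» up to the `2π`-counts, which cancel (`|ν| − |κ| = (|ν| − |μ|) + (|μ| − |κ|)`). -/
theorem logAbsDet_threeSystems (H : Matrix ν ν ℝ) (Q : Matrix μ ν ℝ) (T : Matrix κ μ ℝ) (h : (kkt H Q).det ≠ 0)
    (hC : (kkt (effForm H Q) T).det ≠ 0) :
    Real.log |(kkt H (T * Q)).det| = Real.log |(kkt H Q).det| + Real.log |(kkt (effForm H Q) T).det| := by
  rw [absDet_threeSystems H Q T h, Real.log_mul (abs_ne_zero.mpr h) (abs_ne_zero.mpr hC)]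

/-- [folklore] **THE SECOND VARIATION OF THE THREE-SYSTEM IDENTITY ALONG A `C²` BACKGROUND CURVE** (leaf (H1) of road FP's horizontal route at
MODEL level).  Data: `C²` curves `u ↦ H(u)` (fine form, gauge weight inside), `u ↦ Q(u)` (block averaging), a background-INDEPENDENT coarse slice `T`, and
ANY `C²` curve `u ↦ E(u)` that COINCIDES with the effective form `effForm (H u) (Q u)` near `u = 0` (first jets near `0`, second jets at `0`, all displayed);
Bałaban's bordered system non-degenerate at `0` and the coarse effective system non-degenerate at `0`.  CONCLUSION at `u = 0`:
`secondVar (kkt H (T·Q)) (kkt H₁ (T·Q₁)) (kkt H₂ (T·Q₂)) = secondVar (kkt H Q) (kkt H₁ Q₁) (kkt H₂ Q₂) + secondVar (kkt E T) (kkt E₁ 0) (kkt E₂ 0)`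
— «one-loop (fine, unconstrained) = one-loop (Bałaban's one shot) + one-loop (coarse effective)», i.e. `2·(½·tadpole − ½·bubble)` of each. -/
theorem secondVar_threeSystems
    {H H₁ : ℝ → ν → ν → ℝ} {H₂ : Matrix ν ν ℝ} {Q Q₁ : ℝ → μ → ν → ℝ} {Q₂ : Matrix μ ν ℝ}
    {E E₁ : ℝ → μ → μ → ℝ} {E₂ : Matrix μ μ ℝ} (T : Matrix κ μ ℝ)
    (hH : ∀ᶠ u in 𝓝 (0 : ℝ), HasDerivAt H (H₁ u) u) (hH₁ : HasDerivAt H₁ (Matrix.of.symm H₂) 0)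
    (hQ : ∀ᶠ u in 𝓝 (0 : ℝ), HasDerivAt Q (Q₁ u) u) (hQ₁ : HasDerivAt Q₁ (Matrix.of.symm Q₂) 0)
    (hE : ∀ᶠ u in 𝓝 (0 : ℝ), HasDerivAt E (E₁ u) u) (hE₁ : HasDerivAt E₁ (Matrix.of.symm E₂) 0)
    (hEeq : ∀ᶠ u in 𝓝 (0 : ℝ), Matrix.of (E u) = effForm (Matrix.of (H u)) (Matrix.of (Q u)))
    (hB : (kkt (Matrix.of (H 0)) (Matrix.of (Q 0))).det ≠ 0) (hC : (kkt (Matrix.of (E 0)) T).det ≠ 0) :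
    secondVar (kkt (Matrix.of (H 0)) (T * Matrix.of (Q 0))) (kkt (Matrix.of (H₁ 0)) (T * Matrix.of (Q₁ 0))) (kkt H₂ (T * Q₂))
      = secondVar (kkt (Matrix.of (H 0)) (Matrix.of (Q 0))) (kkt (Matrix.of (H₁ 0)) (Matrix.of (Q₁ 0))) (kkt H₂ Q₂)
        + secondVar (kkt (Matrix.of (E 0)) T) (kkt (Matrix.of (E₁ 0)) (0 : Matrix κ μ ℝ)) (kkt E₂ (0 : Matrix κ μ ℝ)) := by
  -- the first jets, read as matrices (`Matrix.of ∘ Matrix.of.symm = id` definitionally)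
  have hH' : ∀ᶠ u in 𝓝 (0 : ℝ), HasDerivAt H (Matrix.of.symm (Matrix.of (H₁ u))) u := hH
  have hQ' : ∀ᶠ u in 𝓝 (0 : ℝ), HasDerivAt Q (Matrix.of.symm (Matrix.of (Q₁ u))) u := hQ
  have hE' : ∀ᶠ u in 𝓝 (0 : ℝ), HasDerivAt E (Matrix.of.symm (Matrix.of (E₁ u))) u := hE
  -- (F) jets of the fine-unconstrained bordered curve `u ↦ kkt H(u) (T·Q(u))`
  have hFd : ∀ᶠ u in 𝓝 (0 : ℝ), HasDerivAt (fun u => Matrix.of.symm (kkt (Matrix.of (H u)) (T * Matrix.of (Q u))))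
      ((fun u => Matrix.of.symm (kkt (Matrix.of (H₁ u)) (T * Matrix.of (Q₁ u)))) u) u := by
    filter_upwards [hH', hQ'] with u huH huQ
    exact hasDerivAt_kkt (Q := fun u => Matrix.of.symm (T * Matrix.of (Q u))) huH (hasDerivAt_const_mul T huQ)
  have hF₁d : HasDerivAt (fun u => Matrix.of.symm (kkt (Matrix.of (H₁ u)) (T * Matrix.of (Q₁ u))))
      (Matrix.of.symm (kkt H₂ (T * Q₂))) 0 :=
    hasDerivAt_kkt (Q := fun u => Matrix.of.symm (T * Matrix.of (Q₁ u))) hH₁ (hasDerivAt_const_mul T hQ₁)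
  -- (B) jets of Bałaban's bordered curve `u ↦ kkt H(u) Q(u)`
  have hBd : ∀ᶠ u in 𝓝 (0 : ℝ), HasDerivAt (fun u => Matrix.of.symm (kkt (Matrix.of (H u)) (Matrix.of (Q u))))
      ((fun u => Matrix.of.symm (kkt (Matrix.of (H₁ u)) (Matrix.of (Q₁ u)))) u) u := by
    filter_upwards [hH', hQ'] with u huH huQ
    exact hasDerivAt_kkt huH huQ
  have hB₁d : HasDerivAt (fun u => Matrix.of.symm (kkt (Matrix.of (H₁ u)) (Matrix.of (Q₁ u)))) (Matrix.of.symm (kkt H₂ Q₂)) 0 :=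
    hasDerivAt_kkt hH₁ hQ₁
  -- (C) jets of the coarse effective bordered curve `u ↦ kkt E(u) T`
  have hCd : ∀ᶠ u in 𝓝 (0 : ℝ), HasDerivAt (fun u => Matrix.of.symm (kkt (Matrix.of (E u)) T))
      ((fun u => Matrix.of.symm (kkt (Matrix.of (E₁ u)) (0 : Matrix κ μ ℝ))) u) u := by
    filter_upwards [hE'] with u huE
    exact hasDerivAt_kkt (Q := fun _ => Matrix.of.symm T) (Q' := (0 : Matrix κ μ ℝ)) huE (hasDerivAt_const u _)
  have hC₁d : HasDerivAt (fun u => Matrix.of.symm (kkt (Matrix.of (E₁ u)) (0 : Matrix κ μ ℝ))) (Matrix.of.symm (kkt E₂ (0 : Matrix κ μ ℝ))) 0 :=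
    hasDerivAt_kkt (Q := fun _ => Matrix.of.symm (0 : Matrix κ μ ℝ)) (Q' := (0 : Matrix κ μ ℝ)) hE₁ (hasDerivAt_const (0 : ℝ) _)
  -- non-degeneracy at `0` of the three systems
  have hE0 : Matrix.of (E 0) = effForm (Matrix.of (H 0)) (Matrix.of (Q 0)) := hEeq.self_of_nhds
  have hC0 : (kkt (effForm (Matrix.of (H 0)) (Matrix.of (Q 0))) T).det ≠ 0 := by rw [← hE0]; exact hC
  have hF0 : (kkt (Matrix.of (H 0)) (T * Matrix.of (Q 0))).det ≠ 0 := (det_threeSystems_ne_zero_iff _ _ T hB).mpr hC0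
  -- Bałaban's bordered determinant stays non-zero near `0`, hence the identity holds near `0`
  have hBne : ∀ᶠ u in 𝓝 (0 : ℝ), (Matrix.of (Matrix.of.symm (kkt (Matrix.of (H u)) (Matrix.of (Q u))))).det ≠ 0 :=
    eventually_det_ne_zero (hBd.self_of_nhds).hasFDerivAt hB
  have hCne : ∀ᶠ u in 𝓝 (0 : ℝ), (Matrix.of (Matrix.of.symm (kkt (Matrix.of (E u)) T))).det ≠ 0 :=
    eventually_det_ne_zero (hCd.self_of_nhds).hasFDerivAt hC
  have heq : ∀ᶠ u in 𝓝 (0 : ℝ),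
      (1 : ℝ) * Real.log |(Matrix.of (Matrix.of.symm (kkt (Matrix.of (H u)) (T * Matrix.of (Q u))))).det|
        + (-1) * Real.log |(Matrix.of (Matrix.of.symm (kkt (Matrix.of (H u)) (Matrix.of (Q u))))).det|
        + (-1) * Real.log |(Matrix.of (Matrix.of.symm (kkt (Matrix.of (E u)) T))).det|
        + 0 * Real.log |(Matrix.of (Matrix.of.symm (kkt (Matrix.of (E u)) T))).det| = 0 := by
    filter_upwards [hBne, hCne, hEeq] with u huB huC huE
    have huB' : (kkt (Matrix.of (H u)) (Matrix.of (Q u))).det ≠ 0 := huB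
    have huC' : (kkt (effForm (Matrix.of (H u)) (Matrix.of (Q u))) T).det ≠ 0 := by rw [← huE]; exact huC
    have hlog := logAbsDet_threeSystems (Matrix.of (H u)) (Matrix.of (Q u)) T huB' huC'
    rw [← huE] at hlog
    show (1 : ℝ) * Real.log |(kkt (Matrix.of (H u)) (T * Matrix.of (Q u))).det|
        + (-1) * Real.log |(kkt (Matrix.of (H u)) (Matrix.of (Q u))).det|
        + (-1) * Real.log |(kkt (Matrix.of (E u)) T).det| + 0 * Real.log |(kkt (Matrix.of (E u)) T).det| = 0
    rw [hlog]; ring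
  -- differentiate twice (`secondVar_comb_eq_zero` with coefficients `1, −1, −1, 0`)
  have h := secondVar_comb_eq_zero (a := 1) (b := -1) (c := -1) (d := 0) (k := 0) (t := 0)
    hFd hF₁d hF0 hBd hB₁d hB hCd hC₁d hC hCd hC₁d hC heq
  -- read the conclusion
  simp only [one_mul, neg_one_mul, zero_mul, add_zero] at h
  have h' : secondVar (kkt (Matrix.of (H 0)) (T * Matrix.of (Q 0))) (kkt (Matrix.of (H₁ 0)) (T * Matrix.of (Q₁ 0))) (kkt H₂ (T * Q₂))
      - secondVar (kkt (Matrix.of (H 0)) (Matrix.of (Q 0))) (kkt (Matrix.of (H₁ 0)) (Matrix.of (Q₁ 0))) (kkt H₂ Q₂)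
      - secondVar (kkt (Matrix.of (E 0)) T) (kkt (Matrix.of (E₁ 0)) (0 : Matrix κ μ ℝ)) (kkt E₂ (0 : Matrix κ μ ℝ)) = 0 := by
    have : ∀ x y z : ℝ, x + -y + -z = x - y - z := fun x y z => by ring
    rw [← this]; exact h
  linarith

end Real

end Summit.QuantumFields.BalabanUV.Beta.FP.HorizontalModel

end
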